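import Summits.Langlands.Langlands.Theorems.RamifiedCoefficientSeedAdjointLiftingGL3BirthDefs3
import Summits.Langlands.Langlands.Theorems.RamifiedCoefficientSeedAdjointLiftingGL3StubGaloisSeedFrob
import Summits.Langlands.Langlands.Theorems.RamifiedCoefficientSeedAdjointLiftingGL3StubGaloisSeedSelfTwist
import Summits.Langlands.Langlands.Theorems.RamifiedCoefficientSeedAdjointLiftingGL3StubGaloisSeedResidual
import Summits.Langlands.Langlands.Theorems.RamifiedCoefficientSeedAdjointLiftingGL3StubGaloisSeedDict
import Summits.Langlands.Langlands.Theorems.RamifiedCoefficientSeedAdjointLiftingGL3StubGaloisSeedCompat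
import Summits.Langlands.Langlands.Theorems.RamifiedCoefficientSeedAdjointLiftingGL3StubResidualAdjointFormFrame
import Summits.Langlands.Langlands.Theorems.RamifiedCoefficientSeedAdjointLiftingGL3StubResidualAdjointFormIrred
import Literature.NumberTheory.EllipticCurves.NewformGaloisRepPadicAlgClProofs
import Literature.NumberTheory.EllipticCurves.NewformGaloisRepThm61OfTheoremAProofs
import Literature.NumberTheory.Automorphic.NewformArchParameterProofs
import Literature.NumberTheory.GaloisRepresentations.WeakAbelianDirectSummandProofs
import Literature.NumberTheory.GaloisRepresentations.OrdinaryTwistedDeterminant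
import Literature.NumberTheory.GaloisRepresentations.ResiduallyReducibleOfStableLine
import Literature.NumberTheory.GaloisRepresentations.ResidualRepUnique
import Literature.RingTheory.Valuation.AlgClosedResidue
import HarnessLib

/-!
# Crux `AdjointLiftingGL3` (stmt-Langlands-16779), line `birth`: stub S6, the Galois seed
# (`stub_galoisSeed`)

Hypothesis (5) of ACC+ Thm. 6.1.1 for `ρ ≅ η ⊗ ad⁰ ρ₀ (mod 𝔪)`: a cuspidal automorphic
representation `π₀` of `GL₃(𝔸_ℚ)` of WEIGHT ZERO, UNRAMIFIED AT `p`, with a framed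
`r = r_ι(π₀) : Γ_ℚ → GL₃(ℚ̄_p)` (Harris–Lan–Taylor–Thorne's property, `HLTT.IsCompatible`) congruent
to `ρ` on traces (`WeightZeroSeedFor`).  Assembly of the registered stub from its hypotheses and
the landed helper files of the line:

1. `k = ℤ̄_p/𝔪` (discrete, algebraically closed, characteristic `p`) and the ALIGNED weight-two
   newform `(g, ι_g, s, τ₀, σ̄ = ω̄^s ⊗ τ₀)` of `WeightTwoNewformAlong` (`ι_g = ι⁻¹ mod 𝔪`);
2. the cuspidal `π = π_g` on `GL₂(𝔸_ℚ)` (`exists_cuspidalAutomorphicRepData_newform`);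
3. `π` has no quadratic self-twist (`not_isQuadraticSelfTwistAE_of_along`: `ad⁰ σ̄ ≅ ad⁰ τ₀` is
   absolutely irreducible; landed `not_isQuadraticSelfTwistAE_of_isAbsIrreducible_adZero`);
4. the finite-order Hecke character `χ` of `μ` (`exists_heckeCharacter_of_isOpen_ker`, Artin
   reciprocity: `μ(Frob_v) = ι⁻¹(χ(ϖ_v))⁻¹`);
5. `π₀ = Ad(π) ⊗ χ` from the hypothesis `AutomorphicAdjointSeed p` (stub S5);
6. `r = r_ι(π₀)` from `theoremA_existence` (weight zero is regular algebraic);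
7. `tr r = (μ ε_p⁻¹) · tr ad⁰ ρ_g` (landed `trace_eq_trace_adZeroTwoTwist`, `ρ_g` from Thm. A via
   `Hida2000_thm326_exists_galoisRep_of_thm61`), and reduction modulo `𝔪`: `μ ε_p⁻¹ ≡ η`
   (`TeichTwistFor`) and `tr²/det − 1` of `ρ_g` and `ρ₀` are congruent (landed
   `charpoly_residual_eq_of_aligned`, `norm_adTrace_sub_lt_one_of_charpoly_eq`), whence
   `AdjointSeed p r ρ₀ η` and `TraceCongruent p ρ r` (`traceCongruent_of_adjointSeed`).
-/

set_option linter.dupNamespace false -- `Summit.Langlands.Langlands` is the mandated namespace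

noncomputable section

namespace Summit.Langlands.Langlands.Cruxes.AdjointLiftingGL3.Birth

open scoped MatrixGroups NumberField Polynomial
open NumberField IsDedekindDomain Field Filter Polynomial IsLocalRing
open Literature.NumberTheory.GaloisRepresentations Literature.NumberTheory.PAdicHodge
open Literature.NumberTheory.Automorphic
open Literature.NumberTheory.EllipticCurves.ModularForms CongruenceSubgroup Rat.HeightOneSpectrum

/-! ## Step 3: no quadratic self-twist -/

section SelfTwist

open scoped Classical

/-- **`π_g` has no quadratic self-twist when `ad⁰ τ₀` is absolutely irreducible.**  Let `π` on
`GL₂(𝔸_ℚ)` carry the unitary Satake pairs of `g ∈ S₂(Γ₁(M))` at `q ∤ M`, let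
`σ̄ : Γ_ℚ → GL₂(k)` (`k` a discrete field with `2 ≠ 0`) be attached to `g` along `ι_g : 𝓞_g → k`
away from a finite set `S` of primes, of the form `σ̄ = c · τ₀` with `τ₀ = P τ₀' P⁻¹` and `ad⁰ τ₀'`
absolutely irreducible.  Then `IsQuadraticSelfTwistAE K π` fails for every quadratic `K`: `Ad⁰ σ̄` is a
conjugate of `Ad⁰ τ₀'` (`Ad` kills scalars, `glAdZeroTwoFrame_scalar`), hence absolutely
irreducible, `σ̄` is irreducible hence semisimple, and `a_q = 0 ⇒ tr σ̄(Frob_q) = ι_g(a_q) = 0`; the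
landed `not_isQuadraticSelfTwistAE_of_isAbsIrreducible_adZero` concludes.
[cite: Gelbart1997, Thm. 5.3.2 (ii)] -/
theorem not_isQuadraticSelfTwistAE_of_along {k : Type*} [Field k] [TopologicalSpace k]
    [DiscreteTopology k] {M : ℕ} [NeZero M] (g : CuspForm (Gamma1 M) 2) (hg : IsNewform1 g)
    {hcpt₂ : isCompact_glFiniteIntegralLevel 2 ℚ} (π : CuspidalAutomorphicRepData 2 ℚ hcpt₂)
    (hsat : ∀ v : HeightOneSpectrum (𝓞 ℚ), ¬ ((primesEquiv v : Nat.Primes) : ℕ) ∣ M →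
      ∃ α : Multiset ℂ, π.1.HasSatakeParamAt v α ∧
        satakePolynomial α = X ^ 2 -
          C (heckeEigenvalue g ((primesEquiv v : Nat.Primes) : ℕ) *
            (((Real.sqrt ((primesEquiv v : Nat.Primes) : ℕ) : ℝ) : ℂ) ^ (1 - (2 : ℤ)))) * X +
          C (nebentypus g ((((primesEquiv v : Nat.Primes) : ℕ) : ℕ) : ZMod M)))
    (ιg : coeffCharIntegers g →+* k) {S : Set ℕ} (hS : S.Finite) (σb : ModPGaloisRep ℚ k 2)
    (hgal : IsGaloisRepOfNewform1Int g ιg S σb)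
    (τ₀ τ₀' : absoluteGaloisGroup ℚ →* GL (Fin 2) k)
    (c : absoluteGaloisGroup ℚ → k)
    (hσb : ∀ γ, ((σb γ : GL (Fin 2) k) :
        Matrix (Fin 2) (Fin 2) k) =
      c γ • ((τ₀ γ : GL (Fin 2) k) :
        Matrix (Fin 2) (Fin 2) k))
    (P : GL (Fin 2) k)
    (hP : ∀ γ, ((τ₀ γ : GL (Fin 2) k) :
        Matrix (Fin 2) (Fin 2) k) =
      (P : Matrix (Fin 2) (Fin 2) k) *
        ((τ₀' γ : GL (Fin 2) k) : Matrix (Fin 2) (Fin 2) _) *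
        ((P⁻¹ : GL (Fin 2) k) : Matrix (Fin 2) (Fin 2) _))
    (hirr : IsAbsIrreducible (adZeroOf τ₀')) (h2 : (2 : k) ≠ 0) :
    ∀ (K : Type) [Field K] [NumberField K] [Algebra ℚ K], Module.finrank ℚ K = 2 →
      ¬ IsQuadraticSelfTwistAE K π.1 := by
  set σm : absoluteGaloisGroup ℚ →* GL (Fin 2) k := σb.toMonoidHom with hσmdef
  have hσm : ∀ γ, σm γ = σb γ := fun _ => rfl
  -- `Ad⁰ σ̄ = Ad⁰ τ₀ = Ad⁰(P) Ad⁰ τ₀' Ad⁰(P)⁻¹`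
  have hc : ∀ γ, c γ ≠ 0 := fun γ h0 => by
    have hdet : ((σb γ : GL (Fin 2) k) : Matrix (Fin 2) (Fin 2) k).det ≠ 0 :=
      (Matrix.isUnits_det_units (σb γ)).ne_zero
    rw [hσb γ, h0, zero_smul] at hdet
    exact hdet Matrix.det_zero
  have hAdσ : ∀ γ, glAdZeroTwoFrame k (σm γ) = glAdZeroTwoFrame k (τ₀ γ) := fun γ => by
    have hu : (((σm γ * (τ₀ γ)⁻¹ : GL (Fin 2) k)) : Matrix (Fin 2) (Fin 2) k) =
        c γ • (1 : Matrix (Fin 2) (Fin 2) k) := by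
      rw [Units.val_mul, hσm, hσb γ, Matrix.smul_mul, ← Units.val_mul, mul_inv_cancel, Units.val_one]
    have h1 : glAdZeroTwoFrame k (σm γ * (τ₀ γ)⁻¹) = 1 := glAdZeroTwoFrame_scalar _ (c γ) hu
    rwa [map_mul, map_inv, mul_inv_eq_one] at h1
  have hPτ : ∀ γ, τ₀' γ = P⁻¹ * τ₀ γ * P := fun γ => by
    have e : τ₀ γ = P * τ₀' γ * P⁻¹ := Units.ext (by rw [Units.val_mul, Units.val_mul]; exact hP γ)
    rw [e]; group
  have habs : IsAbsIrreducible ((glAdZeroTwoFrame k).comp σm) := by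
    refine IsAbsIrreducible.of_conj_smul (τ := adZeroOf τ₀') ((glAdZeroTwoFrame k P)⁻¹) (fun _ => (1 : k))
      (fun γ => ?_) hirr
    rw [one_smul, inv_inv, ← Units.val_mul, ← Units.val_mul]
    congr 1
    change glAdZeroTwoFrame k (τ₀' γ) = (glAdZeroTwoFrame k P)⁻¹ * glAdZeroTwoFrame k (σm γ) * glAdZeroTwoFrame k P
    rw [hAdσ, hPτ, map_mul, map_mul, map_inv]
  have hirrσ : (glRepresentation σm).IsIrreducible :=
    isIrreducible_of_isIrreducible_adZero σm habs.isIrreducible_glRepresentation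
  have hss : (glRepresentation σm).IsSemisimpleRepresentation :=
    (IsSemisimplificationOf.refl_of_isIrreducible hirrσ).1
  -- the Satake pairs and the Frobenius dictionary of `σ̄`, almost everywhere
  set a : HeightOneSpectrum (𝓞 ℚ) → ℂ := fun v =>
    heckeEigenvalue g ((primesEquiv v : Nat.Primes) : ℕ) *
      (((Real.sqrt ((primesEquiv v : Nat.Primes) : ℕ) : ℝ) : ℂ) ^ (1 - (2 : ℤ))) with hadef
  set e : HeightOneSpectrum (𝓞 ℚ) → ℂ := fun v =>
    (nebentypus g ((((primesEquiv v : Nat.Primes) : ℕ) : ℕ) : ZMod M)) with hedef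
  have hMfin : ({q : ℕ | q ∣ M}).Finite :=
    (Set.finite_le_nat M).subset fun q hq => Nat.le_of_dvd (Nat.pos_of_ne_zero (NeZero.ne M)) hq
  have hsat' : ∀ᶠ v : HeightOneSpectrum (𝓞 ℚ) in cofinite, ∃ α : Multiset ℂ,
      π.1.HasSatakeParamAt v α ∧ satakePolynomial α = X ^ 2 - C (a v) * X + C (e v) :=
    (eventually_primesEquiv_not_mem hMfin).mono fun v hv => hsat v hv
  have hdict : ∀ᶠ v : HeightOneSpectrum (𝓞 ℚ) in cofinite, a v = 0 →
      ∀ 𝔓 ∈ v.primesAbove, ∀ Φ : absoluteGaloisGroup ℚ, IsArithFrobAt (𝓞 ℚ) Φ 𝔓 →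
        ((σm Φ : GL (Fin 2) k) : Matrix (Fin 2) (Fin 2) k).trace = 0 := by
    filter_upwards [eventually_primesEquiv_not_mem hS] with v hv hav 𝔓 h𝔓 Φ hΦ
    have hqprime : ((primesEquiv v : Nat.Primes) : ℕ).Prime := (primesEquiv v).2
    obtain ⟨-, Pg, hPg, hσv⟩ := hgal v hv
    -- `a_q = 0`
    have hr0 : (((Real.sqrt ((primesEquiv v : Nat.Primes) : ℕ) : ℝ) : ℂ)) ^ (1 - (2 : ℤ)) ≠ 0 := by
      refine zpow_ne_zero _ ?_
      exact_mod_cast (Real.sqrt_pos.2 (Nat.cast_pos.2 hqprime.pos)).ne'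
    have ha0 : (UpperHalfPlane.qExpansion 1 ⇑g).coeff ((primesEquiv v : Nat.Primes) : ℕ) = 0 := by
      rw [← IsNewform1.heckeEigenvalue_eq_coeff_holds hg hqprime]
      exact (mul_eq_zero.mp hav).resolve_right hr0
    -- the middle coefficient of the integral Hecke polynomial vanishes
    have hPg1 : Pg.coeff 1 = 0 := by
      have h := congrArg (fun Q : Polynomial (coeffCharField g) =>
        (Q.map (algebraMap (coeffCharField g) ℂ)).coeff 1) hPg
      simp only [map_heckePolynomial, coeff_map, coeff_add, coeff_sub, coeff_X_pow, coeff_C_mul,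
        coeff_X_one, coeff_C, mul_one, Nat.one_ne_zero, if_false, OfNat.one_ne_ofNat, zero_sub,
        add_zero, ha0, neg_zero] at h
      have h' : (((Pg.coeff 1 : coeffCharIntegers g) : coeffCharField g) : ℂ) = 0 := h
      exact Subtype.ext (Subtype.ext h')
    have hcp : ((σm Φ : GL (Fin 2) k) : Matrix (Fin 2) (Fin 2) k).charpoly = Pg.map ιg := hσv 𝔓 h𝔓 Φ hΦ
    have htr := (coeff_charpoly_fin_two ((σm Φ : GL (Fin 2) k) : Matrix (Fin 2) (Fin 2) k)).2
    rw [hcp, coeff_map, hPg1, map_zero] at htr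
    exact neg_eq_zero.mp htr.symm
  intro K _ _ _ hK
  exact not_isQuadraticSelfTwistAE_of_isAbsIrreducible_adZero π.1 a e h2 σm
    (isOpen_ker_of_discreteTopology σb) hss habs hsat' hdict K hK

end SelfTwist

/-! ## The stub -/

section Main

/-- `μ(σ)₀₀` has norm `1` for a character `μ : Γ_ℚ → GL₁(ℚ̄_p)` of finite image (it is a root of
unity). [folklore] -/
theorem norm_apply_eq_one_of_finite_range {p : ℕ} [Fact p.Prime]
    (μ : FramedGaloisRep ℚ (PadicAlgCl p) 1) (hμ : (Set.range μ).Finite) (σ : absoluteGaloisGroup ℚ) :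
    ‖((μ σ : GL (Fin 1) (PadicAlgCl p)) : Matrix (Fin 1) (Fin 1) (PadicAlgCl p)) 0 0‖ = 1 := by
  have hfin : (Set.range fun n : ℕ => μ σ ^ n).Finite :=
    hμ.subset (by rintro _ ⟨n, rfl⟩; exact ⟨σ ^ n, map_pow μ σ n⟩)
  obtain ⟨m, n, hmn, hmn'⟩ := Set.Finite.exists_lt_map_eq_of_forall_mem (f := fun n : ℕ => μ σ ^ n)
    (fun n => Set.mem_range_self n) hfin
  have hpow : μ σ ^ (n - m) = 1 := by
    rw [pow_sub _ hmn.le, ← hmn', mul_inv_cancel]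
  have hk : 0 < n - m := Nat.sub_pos_of_lt hmn
  have hx : (((μ σ : GL (Fin 1) (PadicAlgCl p)) : Matrix (Fin 1) (Fin 1) (PadicAlgCl p)) 0 0) ^ (n - m) = 1 := by
    have h := congrArg (fun u : GL (Fin 1) (PadicAlgCl p) => (u : Matrix (Fin 1) (Fin 1) (PadicAlgCl p)).det) hpow
    simp only [Units.val_pow_eq_pow_val, Matrix.det_pow, Matrix.det_fin_one, Units.val_one,
      Matrix.det_one] at h
    exact h
  exact (isOfFinOrder_iff_pow_eq_one.2 ⟨n - m, hk, hx⟩).norm_eq_one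

/-- **Stub S6 of line `birth` (the Galois seed).**  For `p ≥ 11`, `ρ : Γ_ℚ → GL₃(ℚ̄_p)` with
`ρ ≡ η ⊗ ad⁰ ρ₀ (mod 𝔪)` (`AdjointSeed`), `ρ₀` odd with a residual `τ₀` whose `ad⁰` is absolutely
irreducible, a Teichmüller twist `μ ≡ η ε_p` of finite order unramified at `p` (`TeichTwistFor`),
the automorphic adjoint seed (stub S5, hypothesis), Harris–Lan–Taylor–Thorne's Thm. A
(hypotheses), `ι : ℚ̄_p ≃ ℂ` and an ALIGNED weight-two newform for `ρ₀` over every algebraically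
closed discrete `k` of characteristic `p` (`WeightTwoNewformAlong`): there is a weight-zero cuspidal
`π₀` on `GL₃(𝔸_ℚ)`, unramified at `p`, and `r` with HLTT's property of `r_ι(π₀)` congruent to `ρ`
on traces (`WeightZeroSeedFor p ρ ι hcpt`).  See the module docstring for the assembly.
[cite: ACCGHLNSTT2023, Thm. 6.1.1 (5)] [cite: GelbartJacquet1978, Thm. (9.3)]
[cite: HarrisLanTaylorThorneRMS2016, Thm. A (p. 3)] -/
theorem stub_galoisSeed :
    ∀ (p : ℕ) [Fact p.Prime], 11 ≤ p →
      ∀ (ρ : FramedGaloisRep ℚ (PadicAlgCl p) 3) (ρ₀ : FramedGaloisRep ℚ (PadicAlgCl p) 2)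
        (η : FramedGaloisRep ℚ (PadicAlgCl p) 1),
        (ρ.restrictField (CyclotomicField p ℚ)).IsResiduallyAbsIrreducible → ρ₀.IsOdd →
        AdjointSeed p ρ ρ₀ η →
        (∃ τ₀ : absoluteGaloisGroup ℚ →* GL (Fin 2) (padicAlgClResidueField p),
            ρ₀.IsResidualRepOf (RingHom.id _) τ₀ ∧ IsAbsIrreducible (adZeroOf τ₀)) →
        ∀ μ : FramedGaloisRep ℚ (PadicAlgCl p) 1, TeichTwistFor p η μ →
        AutomorphicAdjointSeed p →
        HarrisLanTaylorThorne2016.theoremA_existence → HarrisLanTaylorThorne2016.theoremA_uniqueness →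
        ∀ (ι : PadicAlgCl p ≃+* ℂ),
          (∀ (k : Type) [Field k] [CharP k p] [IsAlgClosed k] [TopologicalSpace k]
              [DiscreteTopology k] (ιk : padicAlgClResidueField p →+* k),
              WeightTwoNewformAlong p ρ₀ ι k ιk) →
          ∀ (hcpt : isCompact_glFiniteIntegralLevel 3 ℚ), WeightZeroSeedFor p ρ ι hcpt := by
  intro p _ hp ρ ρ₀ η _ _ hseed hτ₀' μ hμ hAAS hA _ ι halong hcpt
  classical
  obtain ⟨τ₀', hτ₀', hirr'⟩ := hτ₀'
  obtain ⟨hμfin, hμunr, hμcong⟩ := hμ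
  have hpp : p.Prime := Fact.out
  -- (1) the residue field `k = ℤ̄_p/𝔪` with the discrete topology, and the aligned newform
  letI : TopologicalSpace (padicAlgClResidueField p) := ⊥
  haveI : DiscreteTopology (padicAlgClResidueField p) := ⟨rfl⟩
  haveI : CharP (padicAlgClResidueField p) p := charP_padicAlgClResidueField p
  haveI : IsAlgClosed (padicAlgClResidueField p) :=
    Literature.RingTheory.Valuation.isAlgClosed_residueField (padicAlgClIntegers p)
  obtain ⟨M, hM, g, ιg, s, τ₀, σb, hpM, hg, hgal, hτ₀, hσb, hal⟩ :=
    halong (padicAlgClResidueField p) (RingHom.id _)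
  haveI : NeZero M := hM
  have h2 : (2 : padicAlgClResidueField p) ≠ 0 := by
    intro h0
    have h' : ((2 : ℕ) : padicAlgClResidueField p) = 0 := by exact_mod_cast h0
    rw [CharP.cast_eq_zero_iff (padicAlgClResidueField p) p 2] at h'
    have := Nat.le_of_dvd two_pos h'
    omega
  -- (2) the automorphic representation of `g`
  have hcpt₂ : isCompact_glFiniteIntegralLevel 2 ℚ := isCompact_glFiniteIntegralLevel_holds 2 ℚ
  obtain ⟨π, hπsat, hπarch⟩ := exists_cuspidalAutomorphicRepData_newform (hcpt := hcpt₂) g hg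
  -- (3) no quadratic self-twist
  set c : absoluteGaloisGroup ℚ → padicAlgClResidueField p := fun γ =>
    ZMod.castHom (dvd_refl p) (padicAlgClResidueField p) (((omegaModP p γ) ^ s : (ZMod p)ˣ) : ZMod p)
    with hcdef
  have hσb' : ∀ γ, ((σb γ : GL (Fin 2) (padicAlgClResidueField p)) :
      Matrix (Fin 2) (Fin 2) (padicAlgClResidueField p)) =
        c γ • ((τ₀ γ : GL (Fin 2) (padicAlgClResidueField p)) : Matrix (Fin 2) (Fin 2) _) := fun γ => by
    rw [hσb γ, RingHom.coe_id, Matrix.map_id]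
  obtain ⟨eτ⟩ := IsResidualRepOf.nonempty_equiv hτ₀' hτ₀
  obtain ⟨P, hP⟩ := exists_conj_of_equiv eτ
  have hS : ({q : ℕ | q ∣ M * p}).Finite :=
    (Set.finite_le_nat (M * p)).subset fun q hq =>
      Nat.le_of_dvd (Nat.pos_of_ne_zero (mul_ne_zero (NeZero.ne M) hpp.ne_zero)) hq
  have hnst := not_isQuadraticSelfTwistAE_of_along g hg π hπsat ιg hS σb hgal τ₀ τ₀' c hσb' P hP
    hirr' h2
  -- (4) the Hecke character of `μ`
  haveI : Finite (μ.toMonoidHom.range) := by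
    have h : ((μ.toMonoidHom.range : Set (GL (Fin 1) (PadicAlgCl p)))).Finite := by
      rw [MonoidHom.coe_range]
      exact hμfin
    exact h.to_subtype
  have hμker : IsOpen (μ.toMonoidHom.ker : Set (absoluteGaloisGroup ℚ)) := isOpen_ker_of_finite_range μ
  obtain ⟨χ, -, hχfin, hχ⟩ := FramedGaloisRep.exists_heckeCharacter_of_isOpen_ker μ hμker ι
  -- (5) `π₀ = Ad(π) ⊗ χ`
  obtain ⟨π₀, hw0, hsatp, hsatae⟩ := hAAS hcpt₂ hcpt M g hg hpM π hπsat hπarch hnst χ hχfin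
    (fun v hv => (hχ v (hμunr v hv)).1)
  -- (6) `r = r_ι(π₀)`
  obtain ⟨r, -, hrc⟩ := hA hcpt (Or.inl inferInstance) π₀ hw0.isRegularAlgebraic p ι
  -- (7a) `ρ_g`
  obtain ⟨ρg, hρg, -⟩ := Literature.NumberTheory.EllipticCurves.Hida2000_thm326_exists_galoisRep_of_thm61
    (DeligneSerre1974.thm61_exists_adicGaloisRep_of_theoremA hA) g le_rfl hg p ι
  -- (7d) `tr r = tr ((μ ε⁻¹) ⊗ ad⁰ ρ_g)`
  have hμev : ∀ᶠ v : HeightOneSpectrum (𝓞 ℚ) in cofinite,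
      μ.HasFrobCharpolyAt v (X - C (ι.symm (χ.valueAtUniformizer v)⁻¹)) :=
    (μ.eventually_isUnramifiedAt_of_isOpen_ker hμker).mono fun v hv => (hχ v hv).2
  have htr := trace_eq_trace_adZeroTwoTwist g hg ι π π₀ χ μ ρg r hπsat hsatae hμev hρg hrc
  -- (7e) reduction modulo `𝔪`
  obtain ⟨τg, hτg⟩ := ρg.exists_isResidualRepOf_fin_two
  have hal' : ∀ x : coeffCharIntegers g,
      ∃ hx : ι.symm ((x : coeffCharField g) : ℂ) ∈ padicAlgClIntegers p,
        ιg x = residue (padicAlgClIntegers p) ⟨ι.symm ((x : coeffCharField g) : ℂ), hx⟩ := fun x => by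
    obtain ⟨hx, e⟩ := hal x
    exact ⟨hx, e⟩
  have hdict := charpoly_residual_eq_of_aligned g ι ιg _ hS σb ρg τg hgal hρg hal' hτg
  have hc : ∀ γ, c γ ≠ 0 := fun γ h0 => by
    have hdet : ((σb γ : GL (Fin 2) (padicAlgClResidueField p)) :
        Matrix (Fin 2) (Fin 2) (padicAlgClResidueField p)).det ≠ 0 :=
      (Matrix.isUnits_det_units (σb γ)).ne_zero
    rw [hσb' γ, h0, zero_smul] at hdet
    exact hdet Matrix.det_zero
  have had := norm_adTrace_sub_lt_one_of_charpoly_eq _ _ τg τ₀ c hτg.hasResidualCharpolys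
    hτ₀.hasResidualCharpolys hc (fun γ => by rw [hdict γ, hσb' γ])
  have hseed' : AdjointSeed p r ρ₀ η := fun σ => by
    rw [htr σ, trace_adZeroTwoTwist, coe_detMulCycInv_apply]
    have hcycv : ((cyclotomicPadicAlgCl ℚ p σ : (PadicAlgCl p)ˣ) : PadicAlgCl p) = cycPadicAlgCl p σ :=
      coe_cyclotomicPadicAlgCl_apply p σ
    have hcyc1 : ‖cycPadicAlgCl p σ‖ = 1 := by
      rw [← hcycv, coe_cyclotomicPadicAlgCl_apply, norm_algebraMap', ← PadicInt.norm_def]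
      exact PadicInt.isUnit_iff.mp (Units.isUnit _)
    have hcyc0 : cycPadicAlgCl p σ ≠ 0 := fun h => by rw [h, norm_zero] at hcyc1; exact zero_ne_one hcyc1
    rw [hcycv]
    refine norm_mul_sub_mul_lt_one _ _ _ _ ?_ ?_ ?_ (had σ)
    · rw [norm_mul, norm_inv, hcyc1, inv_one, mul_one, norm_apply_eq_one_of_finite_range μ hμfin σ]
    · obtain ⟨A, hA, -⟩ := exists_adTrace_integral hτ₀.hasResidualCharpolys σ
      have hA1 : ‖(A : PadicAlgCl p)‖ ≤ 1 := (padicAlgCl_mem_valuationSubring_iff p _).1 A.2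
      rw [hA] at hA1
      exact hA1
    · have e : ((μ σ : GL (Fin 1) (PadicAlgCl p)) : Matrix (Fin 1) (Fin 1) (PadicAlgCl p)) 0 0 *
          (cycPadicAlgCl p σ)⁻¹ -
          ((η σ : GL (Fin 1) (PadicAlgCl p)) : Matrix (Fin 1) (Fin 1) (PadicAlgCl p)) 0 0 =
          (cycPadicAlgCl p σ)⁻¹ *
            (((μ σ : GL (Fin 1) (PadicAlgCl p)) : Matrix (Fin 1) (Fin 1) (PadicAlgCl p)) 0 0 -
              ((η σ : GL (Fin 1) (PadicAlgCl p)) : Matrix (Fin 1) (Fin 1) (PadicAlgCl p)) 0 0 *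
                cycPadicAlgCl p σ) := by
        field_simp
      rw [e, norm_mul, norm_inv, hcyc1, inv_one, one_mul]
      exact hμcong σ
  refine ⟨π₀, r, hw0, fun v hv => ?_, hrc, traceCongruent_of_adjointSeed hseed hseed'⟩
  -- `π₀` is unramified at the place above `p`
  have hvp : natGenerator v = p :=
    (Nat.prime_dvd_prime_iff_eq (prime_natGenerator v) hpp).mp ((Rat.natCast_mem_asIdeal_iff v).mp hv)
  have hvM : ¬ ((primesEquiv v : Nat.Primes) : ℕ) ∣ M := by
    change ¬ natGenerator v ∣ M
    rw [hvp]
    exact hpM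
  obtain ⟨α, hα, -⟩ := hπsat v hvM
  exact ⟨_, hsatp v hv α hα⟩

end Main

end Summit.Langlands.Langlands.Cruxes.AdjointLiftingGL3.Birth

end
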